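import Summits.QuantumFields.BalabanUV.Beta.GAN24.DerivativeRateTransferStraightenJet

/-!
# `BalabanUV.Beta.GAN24.DerivativeRateTransferFlatPoint` — binder row G-an2-4 ∕ (CONV-C), route R6 «VALUES, NOT DERIVATIVES», PART 40:
# THE REAL ROAD TO THE FIRST-DERIVATIVE ROWS — an1's `dEffForm` one-step difference split at the flat point WITHOUT complexification and WITHOUT a
# radius in the constraint jets: `dEffForm = ℋᵀKℋ` (PART 39 §4, `K = H₁ − (Q₁ᵀ𝒮Q + Qᵀ𝒮Q₁)` REAL symmetric), the three-term split through a
# prolongation, the legs in energy, ONE jet-consistency row (CONS₁) and a product-form sector letter for `K′`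
# (unit b2b-balaban-gan24-p3, gen 39; gan24-idea-1 g47's lens item 4 «HF-1», scratch `FlatPointDerivativeSketch` 7628094d5219a880, re-typed with credit at its first
# refusal (Q-47-3), with the jet letter generalised from `H₁` to the FULL first-order letter `K` so that the Q-jets are covered)

NOT IN PRINT; OUR PROOF (for the ROUTE; [folklore] finite-dimensional algebra — PART 18 `DerivativeRateTransferLoewnerKKT` rows, PART 39 `dEffForm_eq_jet_sandwich`,
an2's bordered letters BY NAME).  HONEST FRAMING (cell contract, verbatim): «discharging `BetaPertH` makes Bałaban's UV stability UNCONDITIONAL — a real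
constructive-QFT result; it is NOT the continuum limit and NOT the Clay problem.»  HONEST DEPENDENCY (verbatim): «continuum YM on T⁴ ⇐ BetaPertH ∧ nine spine
estimates (0/9 proved); BetaPertH ⇐ (D1) ∧ (D4) ∧ CAP+tail; G-an2-4 gates asym, D1 and NE2/3/4.»

WHY THIS FILE.  PARTs 35–37 reach an1's `dEffForm` rows through the COMPLEX road (S2 discharged on the axial slice, exponent `θ^{1−r}`); with constraint
jets that road needs a radius (PART 38∕39: `W(z)` invertible + the accretive letters of the straightened form).  gan24-idea-1 g47's «HF-1» goes the REAL
road: no complexification, hence NO radius — and since `dEffForm H Q H₁ Q₁ = ℋᵀ·K·ℋ` with the REAL symmetric `K = H₁ − (Q₁ᵀ𝒮Q + Qᵀ𝒮Q₁)` (PART 39 §4),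
the Q-jets ride along inside `K`.  One step `(H,Q,K) → (H′,Q′,K′)` through a prolongation `P` with `Q′P = Q`: `⟨x′,K′y′⟩ − ⟨x,Ky⟩ = −⟨Px − x′,K′y′⟩ −
⟨Px,K′(Py − y′)⟩ + ⟨x,(PᵀK′P − K)y⟩` (§1) at the minimisers `x = ℋe_a`, `y = ℋe_b`, `x′ = ℋ′e_a`, `y′ = ℋ′e_b`: the legs `Pℋe − ℋ′e` are FLUCTUATIONS
(`Q′(Pℋe − ℋ′e) = 0`), entering as a HYPOTHESIS `≤ ℓ` in energy — the consumer's suppliers are PART 18 `leg_energy_step_rate_of_stab_of_cons` or PART 32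
`leg_energy_step_rate_of_stabGram_of_prolGram_of_row`; a product-form sector `⟨x,K′y⟩² ≤ κ²⟨x,S′x⟩⟨y,S′y⟩` (`S′ = H′ + a·Q′ᵀQ′`; = PART 36 `cross_sq_le_of_loewner`'s OUTPUT shape) turns energies into the
bound; the third term is ONE new displayed row (CONS₁) `|⟨ℋe_a,(PᵀK′P − K)ℋe_b⟩| ≤ c₁` — the jet-consistency of the prolongation.  NET (§3∕§4):
`|dEffForm′(a,b) − dEffForm(a,b)| ≤ 2κ√Λ√ℓ + c₁`, tower `≤ 2κ√Λ·√(cst·θ^j) + cst₁·θ^j` — the `√θ` loss on the legs is honest (operator-level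
Cauchy–Schwarz; idea-1 t47 measures the slack), the consistency row carries `θ^j`.

WHAT THIS FILE PROVES (0 sorry, 0 `def`, nothing cited; real letters):
* §1 [folklore; idea-1 g47] `dotProduct_conj_mulVec`, **`split₃`**, `qpart_split`.
* §2 [folklore; idea-1 g47] `dotProduct_aug`, `aug_eq_of_ker` (on fluctuations the regularisation is free), `aug_nonneg`, `abs_le_of_sq_le`, **`cross_le`**.
* §3 `leg_ker`, `minOp_aug_energy`, `prol_aug_energy`, **`flatPoint_step_le`** (one step, for ANY jet letters `K, K′`: `|⟨ℋ′e_a,K′ℋ′e_b⟩ − ⟨ℋe_a,Kℋe_b⟩| ≤ 2κ√Λ√ℓ + c₁`),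
  `single_dotProduct_sandwich`, **`dEffForm_step_le`** (the same ON an1's `dEffForm` rows via PART 39 §4, `K = H₁ − (Q₁ᵀ𝒮Q + Qᵀ𝒮Q₁)`).
* §4 **`flatPoint_tower_le`**, **`dEffForm_tower_le`** (the tower ENDs: `≤ 2κ√Λ·√(cst·θ^j) + cst₁·θ^j`).
WHAT IT DOES NOT DO: supply the legs' rate (PART 18 ∕ PART 32 by name, under (STAB)+(CONS) resp. (STAB)+(PROL)+(ROW)), the sector constant `κ` of `K′_k`
(k-uniform: idea-1 t47 P-47-1 measures `κ_W ≤ 1.19` in a toy; an instance letter), the jet-consistency rows (CONS₁) (NEW, displayed), `Λ`; nothing of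
Bałaban's is instantiated.  SUPPLIER work on route R6 (rank 2, REDUCTION, no seat); no consumer of record; NEVER «G-an2-4 closed»; NOT (CONV-C), NOT D1, NOT
`BetaPertH`, NOT continuum, NOT Clay.  Records: `HOME/b2b-balaban-gan24-p3/WOODBURY-FIBRE.md` v13.9.
-/

noncomputable section

open Matrix

namespace Summit.QuantumFields.BalabanUV.Beta.GAN24.DerivativeRateTransferFlatPoint

open Literature.MathematicalPhysics.QuantumFieldTheory.Balaban1983to89.Beta.Composition (kkt)
open Literature.MathematicalPhysics.QuantumFieldTheory.Balaban1983to89.Beta.CompositionSingular (effForm minOp)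
open Literature.MathematicalPhysics.QuantumFieldTheory.Balaban1983to89.Beta.BorderedJets (dEffForm)
open Summit.QuantumFields.BalabanUV.Beta.GAN24.DerivativeRateTransferLoewnerKKT (dotProduct_effForm_eq_energy mulVec_minOp mulVec_dotProduct_eq
  transpose_eq_of_posSemidef)
open Summit.QuantumFields.BalabanUV.Beta.GAN24.DerivativeRateTransferStraightenJet (dEffForm_eq_jet_sandwich)

/-! ## §1 Algebra at arbitrary vectors [folklore; gan24-idea-1 g47] -/

section Algebra

variable {c ν ν' : Type*} [Fintype c] [Fintype ν] [Fintype ν']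
variable {K : Matrix ν ν ℝ} {K' : Matrix ν' ν' ℝ} {P : Matrix ν' ν ℝ}

/-- [folklore] moving `P` across: `⟨x,(PᵀMP)y⟩ = ⟨Px, M(Py)⟩`. -/
theorem dotProduct_conj_mulVec (M : Matrix ν' ν' ℝ) (x y : ν → ℝ) :
    x ⬝ᵥ ((Pᵀ * M * P) *ᵥ y) = (P *ᵥ x) ⬝ᵥ (M *ᵥ (P *ᵥ y)) := by
  rw [mulVec_dotProduct_eq, mulVec_mulVec, mulVec_mulVec, Matrix.mul_assoc]

/-- **`split₃` — THE THREE-TERM SPLIT** [folklore; gan24-idea-1 g47]: for any jet letters `K, K′`, prolongation `P` and vectors,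
`⟨x′,K′y′⟩ − ⟨x,Ky⟩ = −⟨Px − x′, K′y′⟩ − ⟨Px, K′(Py − y′)⟩ + ⟨x,(PᵀK′P − K)y⟩`. -/
theorem split₃ (x y : ν → ℝ) (x' y' : ν' → ℝ) :
    x' ⬝ᵥ (K' *ᵥ y') - x ⬝ᵥ (K *ᵥ y) =
      -((P *ᵥ x - x') ⬝ᵥ (K' *ᵥ y')) - (P *ᵥ x) ⬝ᵥ (K' *ᵥ (P *ᵥ y - y')) + x ⬝ᵥ ((Pᵀ * K' * P - K) *ᵥ y) := by
  rw [sub_mulVec, dotProduct_sub, dotProduct_conj_mulVec, mulVec_sub, dotProduct_sub, sub_dotProduct]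
  ring

/-- [folklore; gan24-idea-1 g47] the bookkeeping split `R′ᵀS′ − RᵀS = (R′ − R)ᵀS′ + Rᵀ(S′ − S)`. -/
theorem qpart_split (R R' S S' : Matrix c c ℝ) : R'ᵀ * S' - Rᵀ * S = (R' - R)ᵀ * S' + Rᵀ * (S' - S) := by
  rw [transpose_sub, Matrix.sub_mul, Matrix.mul_sub]; abel

end Algebra

/-! ## §2 The product-form sector in Cauchy–Schwarz form; the regularisation is free on fluctuations [folklore; gan24-idea-1 g47] -/

section Sector

variable {c ν' : Type*} [Fintype c] [Fintype ν'] [DecidableEq c] [DecidableEq ν']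
variable {H' K' : Matrix ν' ν' ℝ} {Q' : Matrix c ν' ℝ} {a κ : ℝ}

omit [DecidableEq c] [DecidableEq ν'] in
/-- [folklore] the augmented form at one vector: `⟨u,(H′ + a·Q′ᵀQ′)u⟩ = ⟨u,H′u⟩ + a⟨Q′u,Q′u⟩`. -/
theorem dotProduct_aug (u : ν' → ℝ) :
    u ⬝ᵥ ((H' + a • (Q'ᵀ * Q')) *ᵥ u) = u ⬝ᵥ (H' *ᵥ u) + a * ((Q' *ᵥ u) ⬝ᵥ (Q' *ᵥ u)) := by
  rw [add_mulVec, smul_mulVec, dotProduct_add, dotProduct_smul, smul_eq_mul, ← mulVec_mulVec,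
    ← mulVec_dotProduct_eq Q' u (Q' *ᵥ u)]

omit [DecidableEq c] [DecidableEq ν'] in
/-- **`aug_eq_of_ker`** [folklore; gan24-idea-1 g47]: on fluctuations the regularisation is free — `Q′z = 0 ⟹ ⟨z,(H′ + a·Q′ᵀQ′)z⟩ = ⟨z,H′z⟩`. -/
theorem aug_eq_of_ker {z : ν' → ℝ} (hz : Q' *ᵥ z = 0) :
    z ⬝ᵥ ((H' + a • (Q'ᵀ * Q')) *ᵥ z) = z ⬝ᵥ (H' *ᵥ z) := by
  rw [dotProduct_aug, hz, dotProduct_zero, mul_zero, add_zero]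

omit [DecidableEq c] [DecidableEq ν'] in
/-- [folklore] the augmented form is nonnegative (`H′` PSD, `0 ≤ a`). -/
theorem aug_nonneg (hH' : H'.PosSemidef) (ha : 0 ≤ a) (u : ν' → ℝ) : 0 ≤ u ⬝ᵥ ((H' + a • (Q'ᵀ * Q')) *ᵥ u) := by
  rw [dotProduct_aug]
  have h1 := hH'.dotProduct_mulVec_nonneg u
  simp only [star_trivial] at h1
  have h2 : 0 ≤ (Q' *ᵥ u) ⬝ᵥ (Q' *ᵥ u) := Finset.sum_nonneg fun i _ => mul_self_nonneg _
  nlinarith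

/-- [folklore] from a squared bound to the Cauchy–Schwarz shape: `t² ≤ κ²EF`, `0 ≤ κ`, `0 ≤ E` ⟹ `|t| ≤ κ√E√F`. -/
theorem abs_le_of_sq_le {t E F : ℝ} (hκ : 0 ≤ κ) (hE : 0 ≤ E) (h : t ^ 2 ≤ κ ^ 2 * E * F) :
    |t| ≤ κ * Real.sqrt E * Real.sqrt F := by
  have h1 : |t| ≤ Real.sqrt (κ ^ 2 * E * F) := Real.abs_le_sqrt h
  rwa [Real.sqrt_mul (by positivity), Real.sqrt_mul (by positivity), Real.sqrt_sq hκ] at h1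

omit [DecidableEq c] [DecidableEq ν'] in
/-- **`cross_le`** [folklore; gan24-idea-1 g47]: a product-form sector `⟨x,K′y⟩² ≤ κ²⟨x,S′x⟩⟨y,S′y⟩` (`S′ = H′ + a·Q′ᵀQ′`; PART 36
`cross_sq_le_of_loewner`'s OUTPUT shape, from the Loewner letter `±K′ ≤ κS′`) in Cauchy–Schwarz form. -/
theorem cross_le (hH' : H'.PosSemidef) (ha : 0 ≤ a) (hκ : 0 ≤ κ)
    (hsec : ∀ x y : ν' → ℝ, (x ⬝ᵥ (K' *ᵥ y)) ^ 2 ≤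
      κ ^ 2 * (x ⬝ᵥ ((H' + a • (Q'ᵀ * Q')) *ᵥ x)) * (y ⬝ᵥ ((H' + a • (Q'ᵀ * Q')) *ᵥ y))) (x y : ν' → ℝ) :
    |x ⬝ᵥ (K' *ᵥ y)| ≤ κ * Real.sqrt (x ⬝ᵥ ((H' + a • (Q'ᵀ * Q')) *ᵥ x)) * Real.sqrt (y ⬝ᵥ ((H' + a • (Q'ᵀ * Q')) *ᵥ y)) :=
  abs_le_of_sq_le hκ (aug_nonneg hH' ha x) (hsec x y)

end Sector

/-! ## §3 One step, for any jet letters — and on an1's `dEffForm` rows -/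

section OneStep

variable {c ν ν' : Type*} [Fintype c] [Fintype ν] [Fintype ν'] [DecidableEq c] [DecidableEq ν] [DecidableEq ν']
variable {H K H₁ : Matrix ν ν ℝ} {Q Q₁ : Matrix c ν ℝ} {H' K' H₁' : Matrix ν' ν' ℝ} {Q' Q₁' : Matrix c ν' ℝ} {P : Matrix ν' ν ℝ}
variable {a κ ℓ Λ c₁ : ℝ}

/-- **`leg_ker`** [folklore; gan24-idea-1 g47]: the leg is a fluctuation — `Q′P = Q ⟹ Q′(Pℋv − ℋ′v) = 0`. -/
theorem leg_ker (h : IsUnit (kkt H Q).det) (h' : IsUnit (kkt H' Q').det) (hPQ : Q' * P = Q) (v : c → ℝ) :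
    Q' *ᵥ (P *ᵥ (minOp H Q *ᵥ v) - minOp H' Q' *ᵥ v) = 0 := by
  rw [mulVec_sub, mulVec_mulVec, hPQ, mulVec_minOp h, mulVec_minOp h', sub_self]

/-- [folklore; gan24-idea-1 g47] the augmented energy of the new minimiser: `⟨ℋ′v,(H′ + a·Q′ᵀQ′)ℋ′v⟩ = ⟨v,𝒮′v⟩ + a⟨v,v⟩`. -/
theorem minOp_aug_energy (h' : IsUnit (kkt H' Q').det) (v : c → ℝ) :
    (minOp H' Q' *ᵥ v) ⬝ᵥ ((H' + a • (Q'ᵀ * Q')) *ᵥ (minOp H' Q' *ᵥ v)) = v ⬝ᵥ (effForm H' Q' *ᵥ v) + a * (v ⬝ᵥ v) := by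
  rw [dotProduct_aug, mulVec_minOp h', dotProduct_effForm_eq_energy h']

omit [DecidableEq ν'] in
/-- [folklore; gan24-idea-1 g47] the augmented energy of the prolongated old minimiser: `⟨Pℋv,(H′ + a·Q′ᵀQ′)Pℋv⟩ = ⟨ℋv,(PᵀH′P)ℋv⟩ + a⟨v,v⟩`
(= `𝒮_{vv}` + the (CONS)∕(PROL) row + `a⟨v,v⟩`). -/
theorem prol_aug_energy (h : IsUnit (kkt H Q).det) (hPQ : Q' * P = Q) (v : c → ℝ) :
    (P *ᵥ (minOp H Q *ᵥ v)) ⬝ᵥ ((H' + a • (Q'ᵀ * Q')) *ᵥ (P *ᵥ (minOp H Q *ᵥ v))) =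
      (minOp H Q *ᵥ v) ⬝ᵥ ((Pᵀ * H' * P) *ᵥ (minOp H Q *ᵥ v)) + a * (v ⬝ᵥ v) := by
  have hq : Q' *ᵥ (P *ᵥ (minOp H Q *ᵥ v)) = v := by rw [mulVec_mulVec, hPQ, mulVec_minOp h]
  rw [dotProduct_aug, hq, (dotProduct_conj_mulVec (P := P) H' (minOp H Q *ᵥ v) (minOp H Q *ᵥ v)).symm]

/-- **`flatPoint_step_le` — «HF-1», ONE STEP, FOR ANY JET LETTERS** [our proof; gan24-idea-1 g47's `hf1_step_le` with `H₁ ↦ K`]: new fine form PSD, bordered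
matrices nonsingular, `Q′P = Q`, `0 ≤ a`, `0 ≤ κ`; the product-form sector of `K′` w.r.t. `S′ = H′ + a·Q′ᵀQ′`; legs in energy `≤ ℓ`; augmented energies of
`ℋ′e_y` and `Pℋe_y` `≤ Λ`; the jet-consistency row (CONS₁) `|⟨ℋe_a,(PᵀK′P − K)ℋe_b⟩| ≤ c₁` ⟹ `|⟨ℋ′e_a,K′ℋ′e_b⟩ − ⟨ℋe_a,Kℋe_b⟩| ≤ 2κ√Λ√ℓ + c₁`. -/
theorem flatPoint_step_le (hH' : H'.PosSemidef) (h : IsUnit (kkt H Q).det) (h' : IsUnit (kkt H' Q').det) (hPQ : Q' * P = Q)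
    (ha : 0 ≤ a) (hκ : 0 ≤ κ)
    (hsec : ∀ x y : ν' → ℝ, (x ⬝ᵥ (K' *ᵥ y)) ^ 2 ≤
      κ ^ 2 * (x ⬝ᵥ ((H' + a • (Q'ᵀ * Q')) *ᵥ x)) * (y ⬝ᵥ ((H' + a • (Q'ᵀ * Q')) *ᵥ y)))
    (hleg : ∀ y : c, (P *ᵥ (minOp H Q *ᵥ Pi.single y 1) - minOp H' Q' *ᵥ Pi.single y 1) ⬝ᵥ
      (H' *ᵥ (P *ᵥ (minOp H Q *ᵥ Pi.single y 1) - minOp H' Q' *ᵥ Pi.single y 1)) ≤ ℓ)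
    (hΛ' : ∀ y : c, (minOp H' Q' *ᵥ Pi.single y 1) ⬝ᵥ ((H' + a • (Q'ᵀ * Q')) *ᵥ (minOp H' Q' *ᵥ Pi.single y 1)) ≤ Λ)
    (hΛP : ∀ y : c, (P *ᵥ (minOp H Q *ᵥ Pi.single y 1)) ⬝ᵥ ((H' + a • (Q'ᵀ * Q')) *ᵥ (P *ᵥ (minOp H Q *ᵥ Pi.single y 1))) ≤ Λ)
    (hcons₁ : ∀ a' b' : c, |(minOp H Q *ᵥ Pi.single a' 1) ⬝ᵥ ((Pᵀ * K' * P - K) *ᵥ (minOp H Q *ᵥ Pi.single b' 1))| ≤ c₁)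
    (a₀ b₀ : c) :
    |(minOp H' Q' *ᵥ Pi.single a₀ 1) ⬝ᵥ (K' *ᵥ (minOp H' Q' *ᵥ Pi.single b₀ 1)) -
        (minOp H Q *ᵥ Pi.single a₀ 1) ⬝ᵥ (K *ᵥ (minOp H Q *ᵥ Pi.single b₀ 1))| ≤
      2 * κ * Real.sqrt Λ * Real.sqrt ℓ + c₁ := by
  set x : ν → ℝ := minOp H Q *ᵥ Pi.single a₀ 1 with hx
  set y : ν → ℝ := minOp H Q *ᵥ Pi.single b₀ 1 with hy
  set x' : ν' → ℝ := minOp H' Q' *ᵥ Pi.single a₀ 1 with hx'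
  set y' : ν' → ℝ := minOp H' Q' *ᵥ Pi.single b₀ 1 with hy'
  rw [split₃ (P := P) x y x' y']
  have hza : Q' *ᵥ (P *ᵥ x - x') = 0 := leg_ker h h' hPQ _
  have hzb : Q' *ᵥ (P *ᵥ y - y') = 0 := leg_ker h h' hPQ _
  have hEa : (P *ᵥ x - x') ⬝ᵥ ((H' + a • (Q'ᵀ * Q')) *ᵥ (P *ᵥ x - x')) ≤ ℓ := by rw [aug_eq_of_ker hza]; exact hleg a₀
  have hEb : (P *ᵥ y - y') ⬝ᵥ ((H' + a • (Q'ᵀ * Q')) *ᵥ (P *ᵥ y - y')) ≤ ℓ := by rw [aug_eq_of_ker hzb]; exact hleg b₀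
  have h1 := cross_le hH' ha hκ hsec (P *ᵥ x - x') y'
  have hΛb := hΛ' b₀
  have h1' : |(P *ᵥ x - x') ⬝ᵥ (K' *ᵥ y')| ≤ κ * Real.sqrt ℓ * Real.sqrt Λ := h1.trans (by gcongr)
  have h2 := cross_le hH' ha hκ hsec (P *ᵥ x) (P *ᵥ y - y')
  have hΛa := hΛP a₀
  have h2' : |(P *ᵥ x) ⬝ᵥ (K' *ᵥ (P *ᵥ y - y'))| ≤ κ * Real.sqrt Λ * Real.sqrt ℓ := h2.trans (by gcongr)
  have h3 := hcons₁ a₀ b₀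
  calc |-((P *ᵥ x - x') ⬝ᵥ (K' *ᵥ y')) - (P *ᵥ x) ⬝ᵥ (K' *ᵥ (P *ᵥ y - y')) + x ⬝ᵥ ((Pᵀ * K' * P - K) *ᵥ y)|
      ≤ |-((P *ᵥ x - x') ⬝ᵥ (K' *ᵥ y'))| + |-((P *ᵥ x) ⬝ᵥ (K' *ᵥ (P *ᵥ y - y')))| + |x ⬝ᵥ ((Pᵀ * K' * P - K) *ᵥ y)| := by
        rw [sub_eq_add_neg]; exact abs_add_three _ _ _
    _ ≤ κ * Real.sqrt ℓ * Real.sqrt Λ + κ * Real.sqrt Λ * Real.sqrt ℓ + c₁ := by rw [abs_neg, abs_neg]; gcongr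
    _ = 2 * κ * Real.sqrt Λ * Real.sqrt ℓ + c₁ := by ring

omit [Fintype ν] [DecidableEq ν] in
/-- [folklore] an entry of a sandwiched letter is the letter at the two columns: `e_a·(ℋᵀKℋ)e_b = ⟨ℋe_a, K ℋe_b⟩`. -/
theorem single_dotProduct_sandwich [Fintype ν] (M : Matrix ν c ℝ) (K : Matrix ν ν ℝ) (a₀ b₀ : c) :
    (Mᵀ * K * M) a₀ b₀ = (M *ᵥ Pi.single a₀ 1) ⬝ᵥ (K *ᵥ (M *ᵥ Pi.single b₀ 1)) := by
  rw [← dotProduct_conj_mulVec (P := M) K, Matrix.mulVec_single_one, single_dotProduct, one_mul, Matrix.col_apply]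

/-- **`dEffForm_step_le` — «HF-1» ON an1's FIRST B-JET ROWS** [our proof; PART 39 §4 `dEffForm = ℋᵀKℋ` BY NAME]: symmetric fine forms (`H` symmetric, `H′` PSD),
nonsingular bordered matrices, `Q′P = Q`; with the FULL first-order letters `K = H₁ − (Q₁ᵀ𝒮Q + Qᵀ𝒮Q₁)`, `K′ = H₁′ − (Q₁′ᵀ𝒮′Q′ + Q′ᵀ𝒮′Q₁′)` (REAL symmetric; the
Q-jets ride along — NO radius): the sector of `K′` w.r.t. `S′`, legs `≤ ℓ`, augmented energies `≤ Λ`, (CONS₁) for `(K, K′)` `≤ c₁` ⟹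
`|dEffForm H′ Q′ H₁′ Q₁′ a b − dEffForm H Q H₁ Q₁ a b| ≤ 2κ√Λ√ℓ + c₁`. -/
theorem dEffForm_step_le (hH : Hᵀ = H) (hH' : H'.PosSemidef) (h : IsUnit (kkt H Q).det) (h' : IsUnit (kkt H' Q').det) (hPQ : Q' * P = Q)
    (ha : 0 ≤ a) (hκ : 0 ≤ κ)
    (hsec : ∀ x y : ν' → ℝ, (x ⬝ᵥ ((H₁' - ((Q₁')ᵀ * effForm H' Q' * Q' + (Q')ᵀ * effForm H' Q' * Q₁')) *ᵥ y)) ^ 2 ≤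
      κ ^ 2 * (x ⬝ᵥ ((H' + a • (Q'ᵀ * Q')) *ᵥ x)) * (y ⬝ᵥ ((H' + a • (Q'ᵀ * Q')) *ᵥ y)))
    (hleg : ∀ y : c, (P *ᵥ (minOp H Q *ᵥ Pi.single y 1) - minOp H' Q' *ᵥ Pi.single y 1) ⬝ᵥ
      (H' *ᵥ (P *ᵥ (minOp H Q *ᵥ Pi.single y 1) - minOp H' Q' *ᵥ Pi.single y 1)) ≤ ℓ)
    (hΛ' : ∀ y : c, (minOp H' Q' *ᵥ Pi.single y 1) ⬝ᵥ ((H' + a • (Q'ᵀ * Q')) *ᵥ (minOp H' Q' *ᵥ Pi.single y 1)) ≤ Λ)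
    (hΛP : ∀ y : c, (P *ᵥ (minOp H Q *ᵥ Pi.single y 1)) ⬝ᵥ ((H' + a • (Q'ᵀ * Q')) *ᵥ (P *ᵥ (minOp H Q *ᵥ Pi.single y 1))) ≤ Λ)
    (hcons₁ : ∀ a' b' : c, |(minOp H Q *ᵥ Pi.single a' 1) ⬝ᵥ
      ((Pᵀ * (H₁' - ((Q₁')ᵀ * effForm H' Q' * Q' + (Q')ᵀ * effForm H' Q' * Q₁')) * P
          - (H₁ - (Q₁ᵀ * effForm H Q * Q + Qᵀ * effForm H Q * Q₁))) *ᵥ (minOp H Q *ᵥ Pi.single b' 1))| ≤ c₁)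
    (a₀ b₀ : c) :
    |dEffForm H' Q' H₁' Q₁' a₀ b₀ - dEffForm H Q H₁ Q₁ a₀ b₀| ≤ 2 * κ * Real.sqrt Λ * Real.sqrt ℓ + c₁ := by
  rw [dEffForm_eq_jet_sandwich (transpose_eq_of_posSemidef hH') h', dEffForm_eq_jet_sandwich hH h, single_dotProduct_sandwich,
    single_dotProduct_sandwich]
  exact flatPoint_step_le hH' h h' hPQ ha hκ hsec hleg hΛ' hΛP hcons₁ a₀ b₀

end OneStep

/-! ## §4 The tower ENDs -/

section Tower

variable {c : Type*} [Fintype c] [DecidableEq c]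
variable {ι : ℕ → Type*} [∀ j, Fintype (ι j)] [∀ j, DecidableEq (ι j)]
variable {H K H₁ : ∀ j, Matrix (ι j) (ι j) ℝ} {Qc Q₁ : ∀ j, Matrix c (ι j) ℝ} {P : ∀ j, Matrix (ι (j + 1)) (ι j) ℝ}
variable {a κ Λ cst cst₁ θ : ℝ}

/-- **`flatPoint_tower_le` — «HF-1», THE TOWER END FOR ANY JET LETTERS** [our proof; gan24-idea-1 g47's `hf1_tower_le`]: one-step letters uniform in `j` (`κ, Λ, a`),
legs in energy `≤ cst·θ^j` (a hypothesis; suppliers: PART 18 `leg_energy_step_rate_of_stab_of_cons` ∕ PART 32 `leg_energy_step_rate_of_stabGram_of_prolGram_of_row`),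
jet-consistency rows `≤ cst₁·θ^j` ⟹ `|⟨ℋ_{j+1}e_a,K_{j+1}ℋ_{j+1}e_b⟩ − ⟨ℋ_je_a,K_jℋ_je_b⟩| ≤ 2κ√Λ·√(cst·θ^j) + cst₁·θ^j`. -/
theorem flatPoint_tower_le (hH : ∀ j, (H j).PosSemidef) (hk : ∀ j, IsUnit (kkt (H j) (Qc j)).det)
    (hPQ : ∀ j, Qc (j + 1) * P j = Qc j) (ha : 0 ≤ a) (hκ : 0 ≤ κ)
    (hsec : ∀ j (x y : ι j → ℝ), (x ⬝ᵥ (K j *ᵥ y)) ^ 2 ≤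
      κ ^ 2 * (x ⬝ᵥ ((H j + a • ((Qc j)ᵀ * Qc j)) *ᵥ x)) * (y ⬝ᵥ ((H j + a • ((Qc j)ᵀ * Qc j)) *ᵥ y)))
    (hleg : ∀ j (y : c), (P j *ᵥ (minOp (H j) (Qc j) *ᵥ Pi.single y 1) - minOp (H (j + 1)) (Qc (j + 1)) *ᵥ Pi.single y 1) ⬝ᵥ
      (H (j + 1) *ᵥ (P j *ᵥ (minOp (H j) (Qc j) *ᵥ Pi.single y 1) - minOp (H (j + 1)) (Qc (j + 1)) *ᵥ Pi.single y 1)) ≤ cst * θ ^ j)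
    (hΛ : ∀ j (y : c), (minOp (H j) (Qc j) *ᵥ Pi.single y 1) ⬝ᵥ
      ((H j + a • ((Qc j)ᵀ * Qc j)) *ᵥ (minOp (H j) (Qc j) *ᵥ Pi.single y 1)) ≤ Λ)
    (hΛP : ∀ j (y : c), (P j *ᵥ (minOp (H j) (Qc j) *ᵥ Pi.single y 1)) ⬝ᵥ
      ((H (j + 1) + a • ((Qc (j + 1))ᵀ * Qc (j + 1))) *ᵥ (P j *ᵥ (minOp (H j) (Qc j) *ᵥ Pi.single y 1))) ≤ Λ)
    (hcons₁ : ∀ j (a' b' : c), |(minOp (H j) (Qc j) *ᵥ Pi.single a' 1) ⬝ᵥ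
      (((P j)ᵀ * K (j + 1) * P j - K j) *ᵥ (minOp (H j) (Qc j) *ᵥ Pi.single b' 1))| ≤ cst₁ * θ ^ j) :
    ∀ j (a₀ b₀ : c),
      |(minOp (H (j + 1)) (Qc (j + 1)) *ᵥ Pi.single a₀ 1) ⬝ᵥ (K (j + 1) *ᵥ (minOp (H (j + 1)) (Qc (j + 1)) *ᵥ Pi.single b₀ 1)) -
          (minOp (H j) (Qc j) *ᵥ Pi.single a₀ 1) ⬝ᵥ (K j *ᵥ (minOp (H j) (Qc j) *ᵥ Pi.single b₀ 1))| ≤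
        2 * κ * Real.sqrt Λ * Real.sqrt (cst * θ ^ j) + cst₁ * θ ^ j := fun j a₀ b₀ =>
  flatPoint_step_le (hH (j + 1)) (hk j) (hk (j + 1)) (hPQ j) ha hκ (hsec (j + 1)) (hleg j) (hΛ (j + 1)) (hΛP j) (hcons₁ j) a₀ b₀

/-- **`dEffForm_tower_le` — «HF-1» ON an1's `dEffForm` ROWS ALONG A TOWER** [our proof]: with `K_j := H₁,ⱼ − (Q₁,ⱼᵀ𝒮_jQ_j + Q_jᵀ𝒮_jQ₁,ⱼ)` the FULL first-order
letters (Q-jets included, real symmetric — NO radius), the hypotheses of `flatPoint_tower_le` for `K` ⟹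
`|dEffForm_{j+1}(a,b) − dEffForm_j(a,b)| ≤ 2κ√Λ·√(cst·θ^j) + cst₁·θ^j`. -/
theorem dEffForm_tower_le (hH : ∀ j, (H j).PosSemidef) (hk : ∀ j, IsUnit (kkt (H j) (Qc j)).det)
    (hPQ : ∀ j, Qc (j + 1) * P j = Qc j) (ha : 0 ≤ a) (hκ : 0 ≤ κ)
    (hsec : ∀ j (x y : ι j → ℝ), (x ⬝ᵥ ((H₁ j - ((Q₁ j)ᵀ * effForm (H j) (Qc j) * Qc j + (Qc j)ᵀ * effForm (H j) (Qc j) * Q₁ j)) *ᵥ y)) ^ 2 ≤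
      κ ^ 2 * (x ⬝ᵥ ((H j + a • ((Qc j)ᵀ * Qc j)) *ᵥ x)) * (y ⬝ᵥ ((H j + a • ((Qc j)ᵀ * Qc j)) *ᵥ y)))
    (hleg : ∀ j (y : c), (P j *ᵥ (minOp (H j) (Qc j) *ᵥ Pi.single y 1) - minOp (H (j + 1)) (Qc (j + 1)) *ᵥ Pi.single y 1) ⬝ᵥ
      (H (j + 1) *ᵥ (P j *ᵥ (minOp (H j) (Qc j) *ᵥ Pi.single y 1) - minOp (H (j + 1)) (Qc (j + 1)) *ᵥ Pi.single y 1)) ≤ cst * θ ^ j)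
    (hΛ : ∀ j (y : c), (minOp (H j) (Qc j) *ᵥ Pi.single y 1) ⬝ᵥ
      ((H j + a • ((Qc j)ᵀ * Qc j)) *ᵥ (minOp (H j) (Qc j) *ᵥ Pi.single y 1)) ≤ Λ)
    (hΛP : ∀ j (y : c), (P j *ᵥ (minOp (H j) (Qc j) *ᵥ Pi.single y 1)) ⬝ᵥ
      ((H (j + 1) + a • ((Qc (j + 1))ᵀ * Qc (j + 1))) *ᵥ (P j *ᵥ (minOp (H j) (Qc j) *ᵥ Pi.single y 1))) ≤ Λ)
    (hcons₁ : ∀ j (a' b' : c), |(minOp (H j) (Qc j) *ᵥ Pi.single a' 1) ⬝ᵥ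
      (((P j)ᵀ * (H₁ (j + 1) - ((Q₁ (j + 1))ᵀ * effForm (H (j + 1)) (Qc (j + 1)) * Qc (j + 1)
            + (Qc (j + 1))ᵀ * effForm (H (j + 1)) (Qc (j + 1)) * Q₁ (j + 1))) * P j
          - (H₁ j - ((Q₁ j)ᵀ * effForm (H j) (Qc j) * Qc j + (Qc j)ᵀ * effForm (H j) (Qc j) * Q₁ j))) *ᵥ
        (minOp (H j) (Qc j) *ᵥ Pi.single b' 1))| ≤ cst₁ * θ ^ j) (j : ℕ) (a₀ b₀ : c) :
    |dEffForm (H (j + 1)) (Qc (j + 1)) (H₁ (j + 1)) (Q₁ (j + 1)) a₀ b₀ - dEffForm (H j) (Qc j) (H₁ j) (Q₁ j) a₀ b₀| ≤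
      2 * κ * Real.sqrt Λ * Real.sqrt (cst * θ ^ j) + cst₁ * θ ^ j :=
  dEffForm_step_le (transpose_eq_of_posSemidef (hH j)) (hH (j + 1)) (hk j) (hk (j + 1)) (hPQ j) ha hκ (hsec (j + 1)) (hleg j)
    (hΛ (j + 1)) (hΛP j) (hcons₁ j) a₀ b₀

end Tower

end Summit.QuantumFields.BalabanUV.Beta.GAN24.DerivativeRateTransferFlatPoint

end
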